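import Summits.CriticalPhenomena.PercolationContinuityZ3.Theorems.PercNearOneGluingNoHeavyQuantIndepBlobCarrierCert
import HarnessLib

/-!
# QUANT lane R8, Conjecture DIB\* WHENEVER EVERY LIGHT EXCEEDS HALF THE SHORTFALL (`2a > Cp = 2j − C_H`), any number of lights,
# every floor `1/2 ≤ x < 1` — part (XII) of the cloud series: the carrier certificate (part XI) discharged by parts VIII + X

builds on p205010 (kernel theorem, internal audit signed; external expert review pending)

Support file (`--supports stmt-CriticalPhenomena-4575`), QUANT lane census seat prim-quant-census-1 (gen 16), rung R8 of
`run/shared/lean/prim/quant/LADDER.md`; memo `run/shared/lean/prim/quant/prim-quant-census-1/TRUNCATED-MEAN-G16.md` §4.  Theorems only, no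
definitions, no sorries, standard axioms.

SETTING as in part (XI) `…CarrierCert`: cloud `L` (gates `< x`), heavies off it, `Cp = 2j − C_H > 0`, every light bigger than half the
shortfall (`2a > Cp`) and of size `≤ j`; `B` = the big lights (`x·a > Cp`), `M` = the medium ones.

* `Quant.IndepBlob.bigLight_ell_mono` — `ℓ(h) = h/(x²h + (1 − x)Cp)` is nondecreasing.
* **`Quant.IndepBlob.tail_ge_of_halfShortfall`** — `1/2 ≤ x < 1`, `0 < Cp`, every light with `2a > Cp` and `a ≤ j`, DIB\* credit
  `Σ_L a·κ_x(p) > Cp` ⟹ `x ≤ P(N ≥ j+1)`.  PROOF: the carrier certificate `tail_ge_of_carrierCert` splits, by `sum_powerset_weight_union_mul`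
  (independence of `B` and `M`), into `Q_B·T_M(Cp/x)/Cp + E_B > 1`, where `T_M` is the truncated mean of the medium cloud — `≥ min(C_M, Cp)`, and
  `> Cp` if `C_M > Cp`, by THE TRUNCATED-MEAN THEOREM `truncMean_ge_min` (part VIII, p265152) — and `E_B` the value of the largest open big light
  — `≥ 1 − max(0, 1 − C_B/Cp)·Q_B`, `> 1` if `C_B > Cp`, `≥ 1 − Q_B`, by `bigCloud_value` (part X, p266524); the bookkeeping on `C_B + C_M > Cp`:
  `C_M > Cp`: `Cp(1 − E_B) ≤ Cp·Q_B < T_M·Q_B`; `C_B > Cp`: `1 − E_B < 0`; else `Cp(1 − E_B) ≤ (Cp − C_B)Q_B < C_M·Q_B ≤ T_M·Q_B`.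
* **`Quant.IndepBlob.dibStar_of_halfShortfall`** — the same in DIB\*'s binder shape (`…QuantDIBStar`): floor `1/2 ≤ x < 1`, heavy credit
  `C_H = Σ_{x ≤ g} a·g < 2j`, every blob below the floor of size `≤ j` (DIB\*'s own side condition) and `> (2j − C_H)/2`.
This contains `…BigLights` (p257989), `…TwoMediumLights` (p261101), `…TwoBins` (p261350) and `…AllMedium` (p265536) as special cases.  What is
left of the multi-light corner of DIB\* after this file: clouds containing a light of size `≤ Cp/2` (non-empty outcomes can then be deficient:
LIGHT-DEC proper, `…QuantLightDEC`).  EVIDENCE before the proof (this seat, `code/gen16/hprime_test.py`): the certificate with the (TM) bound on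
143 446 random mixed clouds / 0 failures, minimal normalised margin `6·10⁻⁵` at the one-big-light boundary (where it is the one-light row).

NOVELTY: presearch as in part VII (`…TruncatedMeanIneq`); nearest in-tree: `…BigLights` (all lights big, star on singletons) and `…CloudClamp`.
[this work; this lane's census]; the gluing rows served: [cite: KozmaNitzan2024, Conjecture 3 (p. 15)]; product weights
[cite: Grimmett1999, §1.3 p. 10].
-/

namespace Summit.CriticalPhenomena.PercolationContinuityZ3.Theorems

namespace Quant

namespace IndepBlob

open Finset

variable {κ : Type*} [Fintype κ] [DecidableEq κ]

/-! ### 22. Every light bigger than half the shortfall -/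

/-- `ℓ(h) = h/(x²h + (1 − x)Cp)` is nondecreasing in `h ≥ 0`. [this work] -/
theorem bigLight_ell_mono (x Cp h₁ h₂ : ℝ) (hx1 : x < 1) (hCp : 0 < Cp) (h₁0 : 0 ≤ h₁) (h12 : h₁ ≤ h₂) :
    h₁ / (x ^ 2 * h₁ + (1 - x) * Cp) ≤ h₂ / (x ^ 2 * h₂ + (1 - x) * Cp) := by
  have hc : 0 < (1 - x) * Cp := mul_pos (by linarith) hCp
  have hD₁ : 0 < x ^ 2 * h₁ + (1 - x) * Cp := by nlinarith [sq_nonneg x]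
  have hD₂ : 0 < x ^ 2 * h₂ + (1 - x) * Cp := by nlinarith [sq_nonneg x]
  rw [div_le_div_iff₀ hD₁ hD₂]
  nlinarith

set_option maxHeartbeats 400000 in
/-- **CONJECTURE DIB\* WHENEVER EVERY LIGHT EXCEEDS HALF THE SHORTFALL (any number of lights).**  Gates in `[0,1]`, floor
`1/2 ≤ x < 1`; a cloud `L` of lights (gates `< x`) off which every blob is heavy (`x ≤ p`); the heavy credit falls short
(`C_H < 2j`, `Cp = 2j − C_H > 0`); every light with `2j < C_H + 2·a_k` (bigger than half the shortfall) and `a_k ≤ j`; DIB\* credit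
`2j < C_H + Σ_{k ∈ L} a_k·(p_k − x²)/(1 − x)` ⟹ `x ≤ P(N ≥ j+1)`.  Proof: the carrier certificate with `B` = the big lights (`x·a > Cp`),
discharged by `sum_powerset_weight_union_mul`, the truncated-mean theorem on the medium lights and `bigCloud_value` on the big ones. [this work] -/
theorem tail_ge_of_halfShortfall (p : κ → ℝ) (a : κ → ℕ) (x : ℝ) (hx : 1 / 2 ≤ x) (hx1 : x < 1)
    (hp0 : ∀ k, 0 ≤ p k) (hp1 : ∀ k, p k ≤ 1) (L : Finset κ) (hheavy : ∀ k, k ∉ L → x ≤ p k) (hlight : ∀ k ∈ L, p k < x) (j : ℕ)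
    (hshort : (∑ i ∈ Finset.univ \ L, (a i : ℝ) * p i) < 2 * j)
    (hmid : ∀ k ∈ L, (2 * j : ℝ) < (∑ i ∈ Finset.univ \ L, (a i : ℝ) * p i) + 2 * (a k : ℝ))
    (hsize : ∀ k ∈ L, a k ≤ j)
    (hcredit : (2 * j : ℝ) < (∑ i ∈ Finset.univ \ L, (a i : ℝ) * p i) + ∑ k ∈ L, (a k : ℝ) * ((p k - x ^ 2) / (1 - x))) :
    x ≤ ∑ s : Finset κ, (∏ k, if k ∈ s then p k else 1 - p k) * (if j + 1 ≤ ∑ k ∈ s, a k then (1 : ℝ) else 0) := by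
  have hx0 : 0 < x := by linarith
  have h1x : 0 < 1 - x := by linarith
  set CH : ℝ := ∑ i ∈ Finset.univ \ L, (a i : ℝ) * p i with hCH
  set Cp : ℝ := 2 * j - CH with hCp
  have hCp0 : 0 < Cp := by rw [hCp]; linarith
  have hxCp : 0 < x * Cp := mul_pos hx0 hCp0
  -- carriers = the big lights, `M` = the medium ones
  set B : Finset κ := L.filter (fun k => Cp < x * (a k : ℝ)) with hB
  set M : Finset κ := L.filter (fun k => ¬ Cp < x * (a k : ℝ)) with hM
  have hBM : Disjoint B M := Finset.disjoint_filter_filter_not L L _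
  have hLBM : B ∪ M = L := Finset.filter_union_filter_not_eq _ L
  have hBL : ∀ k ∈ B, k ∈ L := fun k hk => (Finset.mem_filter.1 hk).1
  have hML : ∀ k ∈ M, k ∈ L := fun k hk => (Finset.mem_filter.1 hk).1
  have hBbig : ∀ k ∈ B, Cp < x * (a k : ℝ) := fun k hk => (Finset.mem_filter.1 hk).2
  have hMmed : ∀ k ∈ M, x * (a k : ℝ) ≤ Cp := fun k hk => not_lt.1 (Finset.mem_filter.1 hk).2
  refine tail_ge_of_carrierCert p a x hx0 hx1 hp0 hp1 L hheavy j hmid B (fun k hk => hsize k (hBL k hk)) hBbig ?_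
  -- notation
  set wL : Finset κ → ℝ := fun S => ∏ k ∈ L, (if k ∈ S then p k else 1 - p k) with hwL
  set ℓ : ℝ → ℝ := fun h => h / (x ^ 2 * h + (1 - x) * Cp) with hℓ
  set t : ℝ := Cp / x with ht
  have hxt : x * t = Cp := by rw [ht]; field_simp
  have ht0 : 0 ≤ t := div_nonneg hCp0.le hx0.le
  -- the two value functions
  set V : Finset κ → ℝ := fun T =>
    if T = ∅ then (0 : ℝ) else ((T.sup a : ℕ) : ℝ) / (x ^ 2 * ((T.sup a : ℕ) : ℝ) + (1 - x) * Cp) with hV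
  set PB : Finset κ → ℝ := fun T =>
    if T = ∅ then (0 : ℝ) else x * Cp * (ℓ ((min (∑ k ∈ T, a k) j : ℕ) : ℝ) - 1) with hPB
  set PM : Finset κ → ℝ := fun S' =>
    x * min (∑ k ∈ S', (a k : ℝ)) t - x * Cp + (if S' = ∅ then x * Cp else 0) with hPM
  set I : Finset κ → ℝ := fun T => if T = ∅ then (1 : ℝ) else 0 with hI
  change x * Cp * ∏ k ∈ L, (1 - p k) < ∑ S ∈ L.powerset, wL S *
    (if S ∩ B = ∅ then max 0 (min (x * (((∑ k ∈ S, a k : ℕ) : ℝ) - Cp)) ((1 - x) * Cp))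
      else x * Cp * (((min (∑ k ∈ S ∩ B, a k) j : ℕ) : ℝ) / (x ^ 2 * ((min (∑ k ∈ S ∩ B, a k) j : ℕ) : ℝ) + (1 - x) * Cp) - 1))
  have hwL0 : ∀ S, 0 ≤ wL S := fun S => weightU_nonneg p L (fun k _ => hp0 k) (fun k _ => hp1 k) S
  -- termwise: `Pay(S) ≥ PB(S ∩ B)·1 + I(S ∩ B)·PM(S ∩ M)`
  have hterm : ∀ S ∈ L.powerset, wL S * (PB (S ∩ B) * 1) + wL S * (I (S ∩ B) * PM (S ∩ M)) ≤ wL S *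
      (if S ∩ B = ∅ then max 0 (min (x * (((∑ k ∈ S, a k : ℕ) : ℝ) - Cp)) ((1 - x) * Cp))
        else x * Cp * (((min (∑ k ∈ S ∩ B, a k) j : ℕ) : ℝ) /
          (x ^ 2 * ((min (∑ k ∈ S ∩ B, a k) j : ℕ) : ℝ) + (1 - x) * Cp) - 1)) := by
    intro S hS
    rw [← mul_add]
    refine mul_le_mul_of_nonneg_left ?_ (hwL0 S)
    have hSL : S ⊆ L := Finset.mem_powerset.1 hS
    by_cases hSB : S ∩ B = ∅
    · -- clamp outcomes: `S ⊆ M`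
      have hSM : S ∩ M = S := by
        refine Finset.inter_eq_left.2 fun k hk => ?_
        have hkL := hSL hk
        rw [← hLBM, Finset.mem_union] at hkL
        rcases hkL with hkB | hkM
        · exact absurd (Finset.mem_inter.2 ⟨hk, hkB⟩) (by rw [hSB]; exact Finset.notMem_empty k)
        · exact hkM
      rw [if_pos hSB, hSB, hSM]
      simp only [hPB, hI, if_true, mul_one, zero_add, one_mul, hPM]
      by_cases hS0 : S = ∅
      · subst hS0
        rw [if_pos rfl, Finset.sum_empty, min_eq_left ht0, mul_zero, zero_sub, neg_add_cancel]
        exact le_max_left _ _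
      · rw [if_neg hS0, add_zero]
        have e : x * min (∑ k ∈ S, (a k : ℝ)) t - x * Cp = min (x * (((∑ k ∈ S, a k : ℕ) : ℝ) - Cp)) ((1 - x) * Cp) := by
          rw [mul_min_of_nonneg _ _ hx0.le, hxt, ← min_sub_sub_right, Nat.cast_sum]
          congr 1 <;> ring
        rw [e]
        exact le_max_right _ _
    · -- carrier outcomes
      rw [if_neg hSB]
      simp only [hPB, hI, if_neg hSB, mul_one, zero_mul, add_zero, hℓ]
      exact le_rfl
  have hsum := Finset.sum_le_sum hterm
  rw [Finset.sum_add_distrib] at hsum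
  -- the two product sums
  have hprodB : ∑ S ∈ L.powerset, wL S * (PB (S ∩ B) * 1) =
      (∑ T ∈ B.powerset, (∏ k ∈ B, if k ∈ T then p k else 1 - p k) * PB T) *
        (∑ S' ∈ M.powerset, (∏ k ∈ M, if k ∈ S' then p k else 1 - p k) * (fun _ => (1 : ℝ)) S') := by
    rw [← sum_powerset_weight_union_mul p B M hBM PB (fun _ => (1 : ℝ)), hLBM]
  have hprodM : ∑ S ∈ L.powerset, wL S * (I (S ∩ B) * PM (S ∩ M)) =
      (∑ T ∈ B.powerset, (∏ k ∈ B, if k ∈ T then p k else 1 - p k) * I T) *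
        (∑ S' ∈ M.powerset, (∏ k ∈ M, if k ∈ S' then p k else 1 - p k) * PM S') := by
    rw [← sum_powerset_weight_union_mul p B M hBM I PM, hLBM]
  rw [hprodB, hprodM] at hsum
  have hM1 : ∑ S' ∈ M.powerset, (∏ k ∈ M, if k ∈ S' then p k else 1 - p k) * (fun _ => (1 : ℝ)) S' = 1 := by
    simp only [mul_one]; exact sum_powerset_weight p M
  have hQB : ∑ T ∈ B.powerset, (∏ k ∈ B, if k ∈ T then p k else 1 - p k) * I T = ∏ k ∈ B, (1 - p k) := by
    simp only [hI, mul_ite, mul_one, mul_zero]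
    rw [Finset.sum_ite_eq' B.powerset (∅ : Finset κ), if_pos (Finset.empty_mem_powerset B)]
    exact Finset.prod_congr rfl fun k _ => by rw [if_neg (Finset.notMem_empty k)]
  rw [hM1, mul_one, hQB] at hsum
  set QB : ℝ := ∏ k ∈ B, (1 - p k) with hQBdef
  set QM : ℝ := ∏ k ∈ M, (1 - p k) with hQMdef
  have hQL : ∏ k ∈ L, (1 - p k) = QB * QM := by rw [← hLBM, Finset.prod_union hBM]
  -- the medium side: `Σ w_M PM = x·T_M − x·Cp + x·Cp·Q_M`
  set TM : ℝ := ∑ S' ∈ M.powerset, (∏ k ∈ M, if k ∈ S' then p k else 1 - p k) * min (∑ k ∈ S', (a k : ℝ)) t with hTMdef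
  have hPMsum : ∑ S' ∈ M.powerset, (∏ k ∈ M, if k ∈ S' then p k else 1 - p k) * PM S' = x * TM - x * Cp + x * Cp * QM := by
    have e2 : ∀ S' ∈ M.powerset, (∏ k ∈ M, if k ∈ S' then p k else 1 - p k) * PM S' =
        x * ((∏ k ∈ M, if k ∈ S' then p k else 1 - p k) * min (∑ k ∈ S', (a k : ℝ)) t) -
          x * Cp * (∏ k ∈ M, if k ∈ S' then p k else 1 - p k) +
          (if S' = ∅ then (∏ k ∈ M, if k ∈ S' then p k else 1 - p k) * (x * Cp) else 0) := by
      intro S' _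
      simp only [hPM]
      split_ifs <;> ring
    rw [Finset.sum_congr rfl e2, Finset.sum_add_distrib, Finset.sum_sub_distrib, ← Finset.mul_sum, ← Finset.mul_sum,
      sum_powerset_weight p M, mul_one, Finset.sum_ite_eq' M.powerset (∅ : Finset κ), if_pos (Finset.empty_mem_powerset M)]
    have : (∏ k ∈ M, if k ∈ (∅ : Finset κ) then p k else 1 - p k) = QM :=
      Finset.prod_congr rfl fun k _ => by rw [if_neg (Finset.notMem_empty k)]
    rw [this]; ring
  rw [hPMsum] at hsum
  -- the big side: `Σ w_B PB ≥ x·Cp·(E_B − (1 − Q_B))`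
  set EB : ℝ := ∑ T ∈ B.powerset, (∏ k ∈ B, if k ∈ T then p k else 1 - p k) * V T with hEBdef
  have hBgate : ∀ k ∈ B, 0 ≤ p k ∧ p k < 1 := fun k hk => ⟨hp0 k, (hlight k (hBL k hk)).trans hx1⟩
  have hPBsum : x * Cp * (EB - (1 - QB)) ≤ ∑ T ∈ B.powerset, (∏ k ∈ B, if k ∈ T then p k else 1 - p k) * PB T := by
    have e3 : x * Cp * (EB - (1 - QB)) =
        ∑ T ∈ B.powerset, (∏ k ∈ B, if k ∈ T then p k else 1 - p k) * (x * Cp * (V T - (1 - I T))) := by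
      have : ∑ T ∈ B.powerset, (∏ k ∈ B, if k ∈ T then p k else 1 - p k) * (x * Cp * (V T - (1 - I T))) =
          x * Cp * (∑ T ∈ B.powerset, (∏ k ∈ B, if k ∈ T then p k else 1 - p k) * V T -
            (∑ T ∈ B.powerset, (∏ k ∈ B, if k ∈ T then p k else 1 - p k) -
              ∑ T ∈ B.powerset, (∏ k ∈ B, if k ∈ T then p k else 1 - p k) * I T)) := by
        rw [← Finset.sum_sub_distrib, ← Finset.sum_sub_distrib, Finset.mul_sum]
        exact Finset.sum_congr rfl fun T _ => by ring
      rw [this, sum_powerset_weight p B, hQB]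
    rw [e3]
    refine Finset.sum_le_sum fun T hT => mul_le_mul_of_nonneg_left ?_
      (weightU_nonneg p B (fun k hk => (hBgate k hk).1) (fun k hk => (hBgate k hk).2.le) T)
    have hTB : T ⊆ B := Finset.mem_powerset.1 hT
    by_cases hT0 : T = ∅
    · simp only [hV, hPB, hI, hT0, if_true]; ring_nf; exact le_rfl
    · simp only [hV, hPB, hI, if_neg hT0, sub_zero, hℓ]
      refine mul_le_mul_of_nonneg_left (sub_le_sub_right ?_ 1) hxCp.le
      -- `sup a ≤ min(Σ a, j)` and `ℓ` is monotone
      obtain ⟨k₀, hk₀, hsup⟩ := Finset.exists_mem_eq_sup T (Finset.nonempty_iff_ne_empty.2 hT0) a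
      have hle : T.sup a ≤ min (∑ k ∈ T, a k) j := by
        rw [hsup]
        exact le_min (Finset.single_le_sum (fun i _ => Nat.zero_le _) hk₀) (hsize k₀ (hBL k₀ (hTB hk₀)))
      exact bigLight_ell_mono x Cp _ _ hx1 hCp0 (Nat.cast_nonneg _) (Nat.cast_le.2 hle)
  -- THE TWO THEOREMS: truncated mean of the medium cloud, value of the big cloud
  have hTMthm := truncMean_ge_min x hx hx1 p (fun k => (a k : ℝ)) M.card M rfl t ht0
    (fun k hk => ⟨hp0 k, hlight k (hML k hk)⟩) (fun k _ => Nat.cast_nonneg (a k))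
    (fun k hk => by rw [ht, le_div_iff₀ hx0, mul_comm]; exact hMmed k hk)
  rw [hxt] at hTMthm
  have hBVthm := bigCloud_value p a x Cp hx0 hx1 hCp0 B.card B rfl hBgate (fun k hk => (hBbig k hk).le)
  change min (∑ k ∈ M, (a k : ℝ) * ((p k - x ^ 2) / (1 - x))) Cp ≤ TM ∧
    (Cp < ∑ k ∈ M, (a k : ℝ) * ((p k - x ^ 2) / (1 - x)) → Cp < TM) at hTMthm
  change 1 - max 0 (1 - (∑ k ∈ B, (a k : ℝ) * ((p k - x ^ 2) / (1 - x))) / Cp) * QB ≤ EB ∧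
    (Cp < ∑ k ∈ B, (a k : ℝ) * ((p k - x ^ 2) / (1 - x)) → 1 < EB) ∧ 1 - QB ≤ EB at hBVthm
  set CB : ℝ := ∑ k ∈ B, (a k : ℝ) * ((p k - x ^ 2) / (1 - x)) with hCBdef
  set CM : ℝ := ∑ k ∈ M, (a k : ℝ) * ((p k - x ^ 2) / (1 - x)) with hCMdef
  have hCsplit : ∑ k ∈ L, (a k : ℝ) * ((p k - x ^ 2) / (1 - x)) = CB + CM := by
    rw [← hLBM, Finset.sum_union hBM]
  rw [hCsplit] at hcredit
  have hQB0 : 0 < QB := Finset.prod_pos fun k hk => by linarith [(hBgate k hk).2]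
  have hQM0 : 0 ≤ QM := Finset.prod_nonneg fun k hk => by linarith [hp1 k]
  have hTM0 : 0 ≤ TM := Finset.sum_nonneg fun S' _ =>
    mul_nonneg (weightU_nonneg p M (fun k _ => hp0 k) (fun k _ => hp1 k) S')
      (le_min (Finset.sum_nonneg fun k _ => Nat.cast_nonneg (a k)) ht0)
  -- the certificate reduces to `Cp·(1 − E_B) < Q_B·T_M`
  have hkey : Cp * (1 - EB) < QB * TM := by
    rcases lt_or_ge Cp CM with hCM | hCM
    · -- the mediums alone
      have h1 : Cp < TM := hTMthm.2 hCM
      have h2 : 1 - EB ≤ QB := by linarith [hBVthm.2.2]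
      calc Cp * (1 - EB) ≤ Cp * QB := mul_le_mul_of_nonneg_left h2 hCp0.le
        _ < TM * QB := mul_lt_mul_of_pos_right h1 hQB0
        _ = QB * TM := mul_comm _ _
    · have h1 : CM ≤ TM := by have := hTMthm.1; rw [min_eq_left hCM] at this; exact this
      rcases lt_or_ge Cp CB with hCB | hCB
      · -- the bigs alone
        have h2 : 1 < EB := hBVthm.2.1 hCB
        have : Cp * (1 - EB) < 0 := mul_neg_of_pos_of_neg hCp0 (by linarith)
        linarith [mul_nonneg hQB0.le hTM0]
      · -- both together
        have hm : max 0 (1 - CB / Cp) = 1 - CB / Cp := max_eq_right (by rw [sub_nonneg, div_le_one hCp0]; exact hCB)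
        have h2 := hBVthm.1
        rw [hm] at h2
        have h3 : Cp * (1 - EB) ≤ (Cp - CB) * QB := by
          have : Cp * ((1 - CB / Cp) * QB) = (Cp - CB) * QB := by field_simp
          nlinarith
        have h4 : (Cp - CB) * QB < CM * QB := mul_lt_mul_of_pos_right (by linarith) hQB0
        have h5 : CM * QB ≤ TM * QB := mul_le_mul_of_nonneg_right h1 hQB0.le
        linarith
  rw [hQL]
  nlinarith [hsum, hPBsum, hkey, hQB0, hQM0]

/-- **CONJECTURE DIB\* WHENEVER EVERY LIGHT EXCEEDS HALF THE SHORTFALL** (DIB\*'s binder shape, `…QuantDIBStar`): floor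
`1/2 ≤ x < 1`, gates in `[0,1]`; the heavy credit `C_H = Σ_{x ≤ g} a·g < 2j`; every blob below the floor of size `≤ j` and
`> (2j − C_H)/2`; the DIB\* credit `2j < Σ_k a_k·(g_k | (g_k − x²)/(1 − x))` ⟹ `x ≤ P(Σ_{open} a ≥ j+1)`.  Any number of lights; contains
`dibStar_of_bigLights`, `…twoMediumLights`, `…twoBins`, `…allMedium`. [this work] -/
theorem dibStar_of_halfShortfall (x : ℝ) (hx : 1 / 2 ≤ x) (hx1 : x < 1) (a : κ → ℕ) (g : κ → ℝ) (j : ℕ)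
    (hg : ∀ k, 0 ≤ g k ∧ g k ≤ 1)
    (hshort : (∑ i ∈ Finset.univ.filter (fun i => x ≤ g i), (a i : ℝ) * g i) < 2 * j)
    (hmid : ∀ k, g k < x → (2 * j : ℝ) < (∑ i ∈ Finset.univ.filter (fun i => x ≤ g i), (a i : ℝ) * g i) + 2 * (a k : ℝ))
    (hsize : ∀ k, g k < x → a k ≤ j)
    (hcredit : (2 * j : ℝ) < ∑ k, (a k : ℝ) * (if x ≤ g k then g k else (g k - x ^ 2) / (1 - x))) :
    x ≤ ∑ W : Finset κ, (∏ k, if k ∈ W then g k else 1 - g k) * (if j + 1 ≤ ∑ k ∈ W, a k then (1 : ℝ) else 0) := by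
  set L : Finset κ := Finset.univ.filter (fun k => g k < x) with hL
  have hmemL : ∀ k, k ∈ L ↔ g k < x := fun k => by simp [hL]
  have hUeq : Finset.univ \ L = Finset.univ.filter (fun i => x ≤ g i) := by
    ext i; simp [hL, not_lt]
  have hsplit : ∑ k, (a k : ℝ) * (if x ≤ g k then g k else (g k - x ^ 2) / (1 - x)) =
      (∑ k ∈ Finset.univ \ L, (a k : ℝ) * g k) + ∑ k ∈ L, (a k : ℝ) * ((g k - x ^ 2) / (1 - x)) := by
    rw [← Finset.sum_sdiff (Finset.subset_univ L)]
    congr 1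
    · refine Finset.sum_congr rfl fun k hk => ?_
      have hkL : k ∉ L := (Finset.mem_sdiff.1 hk).2
      rw [if_pos (not_lt.1 fun h => hkL ((hmemL k).2 h))]
    · refine Finset.sum_congr rfl fun k hk => ?_
      rw [if_neg (not_le.2 ((hmemL k).1 hk))]
  rw [hsplit] at hcredit
  rw [← hUeq] at hshort hmid
  exact tail_ge_of_halfShortfall g a x hx hx1 (fun k => (hg k).1) (fun k => (hg k).2) L
    (fun k hk => not_lt.1 fun h => hk ((hmemL k).2 h)) (fun k hk => (hmemL k).1 hk) j hshort
    (fun k hk => hmid k ((hmemL k).1 hk)) (fun k hk => hsize k ((hmemL k).1 hk)) hcredit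

end IndepBlob

end Quant

end Summit.CriticalPhenomena.PercolationContinuityZ3.Theorems
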